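import Summits.ValiantsHypothesis.ValiantsHypothesis.Theorems.LacunarySymmetroidMatrixDescartesCensusTwoRowElbowFive

/-!
# `MatrixDescartes` census — W4: elbow 5 in the kernel — edge `ZP(5..18)` (generic two-row theorems, sharp residual test)

HONEST FRAMING.  Object-search cell `pub-symmetroid`, item `DoorA26 = PosRootLawAt 2 6 19` (stmt-ValiantsHypothesis-19979,
OPEN, typed, never asserted).  Companion of `…CensusTwoRowElbowFive`, which carries the method (Euler twists kill all
but the rows `a₀, a₁` against two columns; the residual tetranomial is bounded by the SHARP monotonicity test
`countP_posRoots_tetranomial_le_one_of_disc` / `…_of_disc'`).  Here: the long edge `5..18` of chamber 1706 (pair-sum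
order of `(0,2,3,7,16,27)`), hull-edge form (EDGE GRAM LEMMA, zero-pattern pencil)
`F₁₈ = (a₀ + a₁X^{d₁} + a₂X^{d₂} + a₃X^{d₃})(c₃X^{d₃} + c₄X^{d₄} + c₅X^{d₅}) − (b₂X^{d₂} + b₃X^{d₃} + b₄X^{d₄})²`
(14 terms; Descartes-sharpness with multiplicity would need 13 positive roots; the theorems give `≤ 11`), in the two
column variants `(c₃,c₄)` and `(c₄,c₅)`.  The four integer multipliers of the kept terms are
NEGATIVE on this edge (hypotheses `h₀..h₃`); the rows (`…TwoRowElbowFiveRows*`) discharge every numeric side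
condition by `norm_num`.  Seat table TWOROW-E1G19 §2 / engine-1 g23 `cover.py`: the two variants together certify
114 of the 115 core supports (misses: `(0,2,3,7,22,40)` — two-row-resistant, dead at cell level by
engine-2 g24/g25's hull certificates).  Nothing in this file bounds `ζ_sym(2,6)`, decides `DoorA26`, or bears on the
crux `MatrixDescartes` (stmt-ValiantsHypothesis-18050) / `VP ≠ VNP`: a dead channel is a statement about hypothetical
objects.

[folklore] Rolle with multiplicity (Euler twists, quotient Rolle) + a discriminant; no single source.
-/

-- `Summit.ValiantsHypothesis.ValiantsHypothesis.…` repeats a component by the D-0017 layout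
-- (single-conjunct summit), which the `dupNamespace` linter flags; the name is mandated.
set_option linter.dupNamespace false

namespace Summit.ValiantsHypothesis.ValiantsHypothesis.Theorems.LacunarySymmetroidMatrixDescartes.Census

open Polynomial Finset
open scoped BigOperators Polynomial

/-! ### Chamber 1706, edge `5..18`: generic two-row theorems, columns `(c₃,c₄)` and `(c₄,c₅)` -/

/-- **Edge `5..18` (chamber 1706), rows `(a₀,a₁)` × columns `(c₃,c₄)` — generic two-row kill, sharp
residual test.**
For natural exponents `d₁,…,d₅` and the four integer multipliers `M₀..M₃` of the kept terms
`a₀c₃X^{d₃}, a₀c₄X^{d₄}, a₁c₃X^{d₁+d₃}, a₁c₄X^{d₁+d₄}` (products over the 10 killed exponents,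
given as explicit hypotheses so that a numeric row discharges them by `norm_num`), all negative, with the
cell's signs on the kept terms and the sharp certificate `m ≥ 0 ∨ m² < 4δ²·(M₀M₃)(M₁M₂)` (`δ = d₁`, `g = d₄ − d₃`,
`m = (δ+g)M₀M₃ + (δ−g)M₁M₂`): the 14-term edge form has at most `11 < 13 = #terms − 1` positive roots counted with
multiplicity. [folklore] -/
theorem countP_posRoots_zp_5_18_le_of_cert34 (d₁ d₂ d₃ d₄ d₅ : ℕ) (M₀ M₁ M₂ M₃ : ℝ)
    (hM₀ : M₀ = ((d₃ : ℝ) - ((2 * d₂ : ℕ) : ℝ)) * ((d₃ : ℝ) - ((d₂ + d₃ : ℕ) : ℝ)) *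
        ((d₃ : ℝ) - ((2 * d₃ : ℕ) : ℝ)) * ((d₃ : ℝ) - ((d₂ + d₄ : ℕ) : ℝ)) * ((d₃ : ℝ) - ((d₃ + d₄ : ℕ) : ℝ)) *
        ((d₃ : ℝ) - (d₅ : ℝ)) * ((d₃ : ℝ) - ((d₁ + d₅ : ℕ) : ℝ)) * ((d₃ : ℝ) - ((d₂ + d₅ : ℕ) : ℝ)) *
        ((d₃ : ℝ) - ((2 * d₄ : ℕ) : ℝ)) * ((d₃ : ℝ) - ((d₃ + d₅ : ℕ) : ℝ)))
    (hM₁ : M₁ = ((d₄ : ℝ) - ((2 * d₂ : ℕ) : ℝ)) * ((d₄ : ℝ) - ((d₂ + d₃ : ℕ) : ℝ)) *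
        ((d₄ : ℝ) - ((2 * d₃ : ℕ) : ℝ)) * ((d₄ : ℝ) - ((d₂ + d₄ : ℕ) : ℝ)) * ((d₄ : ℝ) - ((d₃ + d₄ : ℕ) : ℝ)) *
        ((d₄ : ℝ) - (d₅ : ℝ)) * ((d₄ : ℝ) - ((d₁ + d₅ : ℕ) : ℝ)) * ((d₄ : ℝ) - ((d₂ + d₅ : ℕ) : ℝ)) *
        ((d₄ : ℝ) - ((2 * d₄ : ℕ) : ℝ)) * ((d₄ : ℝ) - ((d₃ + d₅ : ℕ) : ℝ)))
    (hM₂ : M₂ = (((d₁ + d₃ : ℕ) : ℝ) - ((2 * d₂ : ℕ) : ℝ)) * (((d₁ + d₃ : ℕ) : ℝ) - ((d₂ + d₃ : ℕ) : ℝ)) *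
        (((d₁ + d₃ : ℕ) : ℝ) - ((2 * d₃ : ℕ) : ℝ)) * (((d₁ + d₃ : ℕ) : ℝ) - ((d₂ + d₄ : ℕ) : ℝ)) *
        (((d₁ + d₃ : ℕ) : ℝ) - ((d₃ + d₄ : ℕ) : ℝ)) * (((d₁ + d₃ : ℕ) : ℝ) - (d₅ : ℝ)) *
        (((d₁ + d₃ : ℕ) : ℝ) - ((d₁ + d₅ : ℕ) : ℝ)) * (((d₁ + d₃ : ℕ) : ℝ) - ((d₂ + d₅ : ℕ) : ℝ)) *
        (((d₁ + d₃ : ℕ) : ℝ) - ((2 * d₄ : ℕ) : ℝ)) * (((d₁ + d₃ : ℕ) : ℝ) - ((d₃ + d₅ : ℕ) : ℝ)))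
    (hM₃ : M₃ = (((d₁ + d₄ : ℕ) : ℝ) - ((2 * d₂ : ℕ) : ℝ)) * (((d₁ + d₄ : ℕ) : ℝ) - ((d₂ + d₃ : ℕ) : ℝ)) *
        (((d₁ + d₄ : ℕ) : ℝ) - ((2 * d₃ : ℕ) : ℝ)) * (((d₁ + d₄ : ℕ) : ℝ) - ((d₂ + d₄ : ℕ) : ℝ)) *
        (((d₁ + d₄ : ℕ) : ℝ) - ((d₃ + d₄ : ℕ) : ℝ)) * (((d₁ + d₄ : ℕ) : ℝ) - (d₅ : ℝ)) *
        (((d₁ + d₄ : ℕ) : ℝ) - ((d₁ + d₅ : ℕ) : ℝ)) * (((d₁ + d₄ : ℕ) : ℝ) - ((d₂ + d₅ : ℕ) : ℝ)) *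
        (((d₁ + d₄ : ℕ) : ℝ) - ((2 * d₄ : ℕ) : ℝ)) * (((d₁ + d₄ : ℕ) : ℝ) - ((d₃ + d₅ : ℕ) : ℝ)))
    (hd₁ : 0 < d₁) (hjk : d₃ < d₄) (h₀ : M₀ < 0) (h₁ : M₁ < 0) (h₂ : M₂ < 0) (h₃ : M₃ < 0)
    (hcert : 0 ≤ ((d₁ : ℝ) + ((d₄ : ℝ) - (d₃ : ℝ))) * (M₀ * M₃) + ((d₁ : ℝ) - ((d₄ : ℝ) - (d₃ : ℝ))) * (M₁ * M₂) ∨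
      (((d₁ : ℝ) + ((d₄ : ℝ) - (d₃ : ℝ))) * (M₀ * M₃) + ((d₁ : ℝ) - ((d₄ : ℝ) - (d₃ : ℝ))) * (M₁ * M₂)) ^ 2
        < 4 * (d₁ : ℝ) ^ 2 * (M₀ * M₃) * (M₁ * M₂))
    (a₀ a₁ a₂ a₃ c₃ c₄ c₅ b₂ b₃ b₄ : ℝ) (s₀₃ : 0 < a₀ * c₃) (s₀₄ : 0 < a₀ * c₄) (s₁₃ : a₁ * c₃ < 0)
    (s₁₄ : a₁ * c₄ < 0) :
    (((C a₀ + C a₁ * X ^ d₁ + C a₂ * X ^ d₂ + C a₃ * X ^ d₃)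
          * (C c₃ * X ^ d₃ + C c₄ * X ^ d₄ + C c₅ * X ^ d₅)
        - (C b₂ * X ^ d₂ + C b₃ * X ^ d₃ + C b₄ * X ^ d₄) ^ 2 : ℝ[X]).roots.countP
      (fun x => 0 < x)) ≤ 11 := by
  classical
  set e : ℕ → ℕ := fun t => match t with
    | 0 => d₃ | 1 => d₄ | 2 => d₁ + d₃ | 3 => d₁ + d₄ | 4 => 2 * d₂ | 5 => d₂ + d₃ | 6 => 2 * d₃
    | 7 => d₂ + d₄ | 8 => d₃ + d₄ | 9 => d₅ | 10 => d₁ + d₅ | 11 => d₂ + d₅ | 12 => 2 * d₄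
    | 13 => d₃ + d₅ | _ => 0 with he
  set c : ℕ → ℝ := fun t => match t with
    | 0 => a₀ * c₃ | 1 => a₀ * c₄ | 2 => a₁ * c₃ | 3 => a₁ * c₄ | 4 => -(b₂ ^ 2)
    | 5 => a₂ * c₃ - (b₂ * b₃ + b₂ * b₃) | 6 => a₃ * c₃ - b₃ ^ 2
    | 7 => a₂ * c₄ - (b₂ * b₄ + b₂ * b₄) | 8 => a₃ * c₄ - (b₃ * b₄ + b₃ * b₄) | 9 => a₀ * c₅
    | 10 => a₁ * c₅ | 11 => a₂ * c₅ | 12 => -(b₄ ^ 2) | 13 => a₃ * c₅ | _ => 0 with hc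
  have hF : ((C a₀ + C a₁ * X ^ d₁ + C a₂ * X ^ d₂ + C a₃ * X ^ d₃)
          * (C c₃ * X ^ d₃ + C c₄ * X ^ d₄ + C c₅ * X ^ d₅)
        - (C b₂ * X ^ d₂ + C b₃ * X ^ d₃ + C b₄ * X ^ d₄) ^ 2 : ℝ[X])
      = ∑ t ∈ range 14, C (c t) * X ^ (e t) := by
    simp only [Finset.sum_range_succ, Finset.sum_range_zero, zero_add, he, hc, map_mul, map_neg,
      map_pow, map_add, map_sub, pow_add, two_mul]
    ring
  rw [hF]
  clear hF
  have step := countP_posRoots_le_countP_twists 14 e c (Ico 4 14)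
  have hcard : (Ico 4 14).card = 10 := by simp
  rw [hcard] at step
  obtain ⟨M, hM⟩ : ∃ M : ℕ → ℝ, ∀ t, M t = ∏ u ∈ Ico 4 14, ((e t : ℝ) - e u) := ⟨_, fun _ => rfl⟩
  have hres : (∑ t ∈ range 14, C (c t * ∏ u ∈ Ico 4 14, ((e t : ℝ) - e u)) * X ^ (e t) : ℝ[X])
      = C (c 0 * M 0) * X ^ (e 0) + C (c 1 * M 1) * X ^ (e 1) + C (c 2 * M 2) * X ^ (e 2)
        + C (c 3 * M 3) * X ^ (e 3) := by
    rw [Finset.range_eq_Ico, ← Finset.sum_Ico_consecutive _ (show 0 ≤ 4 by norm_num) (show 4 ≤ 14 by norm_num)]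
    have hz : (∑ t ∈ Ico 4 14, C (c t * ∏ u ∈ Ico 4 14, ((e t : ℝ) - e u)) * X ^ (e t) : ℝ[X]) = 0 := by
      refine Finset.sum_eq_zero fun t ht => ?_
      rw [Finset.prod_eq_zero ht (sub_self _), mul_zero, map_zero, zero_mul]
    rw [hz, add_zero, Nat.Ico_zero_eq_range]
    simp only [Finset.sum_range_succ, Finset.sum_range_zero, zero_add, ← hM]
  rw [hres] at step
  clear hres
  have e0 : e 0 = d₃ := rfl
  have e1 : e 1 = d₄ := rfl
  have e2 : e 2 = d₁ + d₃ := rfl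
  have e3 : e 3 = d₁ + d₄ := rfl
  have c0 : c 0 = a₀ * c₃ := rfl
  have c1 : c 1 = a₀ * c₄ := rfl
  have c2 : c 2 = a₁ * c₃ := rfl
  have c3 : c 3 = a₁ * c₄ := rfl
  rw [e0, e1, e2, e3, c0, c1, c2, c3] at step
  have unroll : ∀ t, M t = ((e t : ℝ) - e 4) * ((e t : ℝ) - e 5) * ((e t : ℝ) - e 6) * ((e t : ℝ) - e 7) *
      ((e t : ℝ) - e 8) * ((e t : ℝ) - e 9) * ((e t : ℝ) - e 10) * ((e t : ℝ) - e 11) * ((e t : ℝ) - e 12) *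
      ((e t : ℝ) - e 13) := by
    intro t
    rw [hM, Finset.prod_Ico_eq_prod_range]
    simp only [show (14 : ℕ) - 4 = 10 by norm_num, Finset.prod_range_succ, Finset.prod_range_zero, one_mul,
      Nat.reduceAdd]
  have e4 : e 4 = 2 * d₂ := rfl
  have e5 : e 5 = d₂ + d₃ := rfl
  have e6 : e 6 = 2 * d₃ := rfl
  have e7 : e 7 = d₂ + d₄ := rfl
  have e8 : e 8 = d₃ + d₄ := rfl
  have e9 : e 9 = d₅ := rfl
  have e10 : e 10 = d₁ + d₅ := rfl
  have e11 : e 11 = d₂ + d₅ := rfl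
  have e12 : e 12 = 2 * d₄ := rfl
  have e13 : e 13 = d₃ + d₅ := rfl
  have hM0' : M 0 = M₀ := by
    rw [hM₀, unroll, e0, e4, e5, e6, e7, e8, e9, e10, e11, e12, e13]
  have hM1' : M 1 = M₁ := by
    rw [hM₁, unroll, e1, e4, e5, e6, e7, e8, e9, e10, e11, e12, e13]
  have hM2' : M 2 = M₂ := by
    rw [hM₂, unroll, e2, e4, e5, e6, e7, e8, e9, e10, e11, e12, e13]
  have hM3' : M 3 = M₃ := by
    rw [hM₃, unroll, e3, e4, e5, e6, e7, e8, e9, e10, e11, e12, e13]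
  have hA : a₀ * c₃ * M 0 < 0 := by rw [hM0']; exact mul_neg_of_pos_of_neg s₀₃ h₀
  have hB : a₀ * c₄ * M 1 < 0 := by rw [hM1']; exact mul_neg_of_pos_of_neg s₀₄ h₁
  have hC : 0 < a₁ * c₃ * M 2 := by rw [hM2']; exact mul_pos_of_neg_of_neg s₁₃ h₂
  have hD : 0 < a₁ * c₄ * M 3 := by rw [hM3']; exact mul_pos_of_neg_of_neg s₁₄ h₃
  have hκ : 0 < a₀ * c₄ * -(a₁ * c₃) := mul_pos s₀₄ (neg_pos.2 s₁₃)
  have hg : (((d₄ - d₃ : ℕ) : ℝ)) = (d₄ : ℝ) - (d₃ : ℝ) := by push_cast [hjk.le]; ring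
  have iAD : (-(a₀ * c₃ * M 0) * (a₁ * c₄ * M 3)) = (a₀ * c₄ * -(a₁ * c₃)) * (M₀ * M₃) := by
    rw [hM0', hM3']; ring
  have iBC : (-(a₀ * c₄ * M 1) * (a₁ * c₃ * M 2)) = (a₀ * c₄ * -(a₁ * c₃)) * (M₁ * M₂) := by
    rw [hM1', hM2']; ring
  have hdisc : 0 ≤ ((d₁ : ℝ) + ((d₄ - d₃ : ℕ) : ℝ)) * (-(a₀ * c₃ * M 0) * (a₁ * c₄ * M 3))
        + ((d₁ : ℝ) - ((d₄ - d₃ : ℕ) : ℝ)) * (-(a₀ * c₄ * M 1) * (a₁ * c₃ * M 2)) ∨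
      (((d₁ : ℝ) + ((d₄ - d₃ : ℕ) : ℝ)) * (-(a₀ * c₃ * M 0) * (a₁ * c₄ * M 3))
          + ((d₁ : ℝ) - ((d₄ - d₃ : ℕ) : ℝ)) * (-(a₀ * c₄ * M 1) * (a₁ * c₃ * M 2))) ^ 2
        < 4 * (d₁ : ℝ) ^ 2 * (-(a₀ * c₃ * M 0) * (a₁ * c₄ * M 3)) * (-(a₀ * c₄ * M 1) * (a₁ * c₃ * M 2)) := by
    rw [iAD, iBC, hg]
    set κ := a₀ * c₄ * -(a₁ * c₃) with hκdef
    set md := ((d₁ : ℝ) + ((d₄ : ℝ) - (d₃ : ℝ))) * (M₀ * M₃) + ((d₁ : ℝ) - ((d₄ : ℝ) - (d₃ : ℝ))) * (M₁ * M₂)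
      with hmd
    have i1 : ((d₁ : ℝ) + ((d₄ : ℝ) - (d₃ : ℝ))) * (κ * (M₀ * M₃))
        + ((d₁ : ℝ) - ((d₄ : ℝ) - (d₃ : ℝ))) * (κ * (M₁ * M₂)) = κ * md := by
      rw [hmd]; ring
    have i2 : 4 * (d₁ : ℝ) ^ 2 * (κ * (M₀ * M₃)) * (κ * (M₁ * M₂))
        = κ ^ 2 * (4 * (d₁ : ℝ) ^ 2 * (M₀ * M₃) * (M₁ * M₂)) := by
      ring
    rw [i1, i2]
    rcases hcert with h | h
    · exact Or.inl (mul_nonneg hκ.le h)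
    · right
      rw [mul_pow]
      exact mul_lt_mul_of_pos_left h (pow_pos hκ 2)
  have tet : ((C (a₀ * c₃ * M 0) * X ^ d₃ + C (a₀ * c₄ * M 1) * X ^ d₄ + C (a₁ * c₃ * M 2) * X ^ (d₁ + d₃)
      + C (a₁ * c₄ * M 3) * X ^ (d₁ + d₄) : ℝ[X]).roots.countP (fun x => 0 < x)) ≤ 1 :=
    countP_posRoots_tetranomial_le_one_of_disc' _ _ _ _ hA hB hC hD (g := d₄ - d₃) (δ := d₁)
      hd₁ (Nat.add_sub_of_le hjk.le).symm (Nat.add_comm _ _)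
      (by rw [Nat.add_sub_of_le hjk.le, Nat.add_comm]) hdisc
  exact (step.trans (Nat.add_le_add_right tet _)).trans (by norm_num)

/-- **Edge `5..18` (chamber 1706), rows `(a₀,a₁)` × columns `(c₄,c₅)` — generic two-row kill, sharp
residual test.**
For natural exponents `d₁,…,d₅` and the four integer multipliers `M₀..M₃` of the kept terms
`a₀c₄X^{d₄}, a₀c₅X^{d₅}, a₁c₄X^{d₁+d₄}, a₁c₅X^{d₁+d₅}` (products over the 10 killed exponents,
given as explicit hypotheses so that a numeric row discharges them by `norm_num`), all negative, with the
cell's signs on the kept terms and the sharp certificate `m ≥ 0 ∨ m² < 4δ²·(M₀M₃)(M₁M₂)` (`δ = d₁`, `g = d₅ − d₄`,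
`m = (δ+g)M₀M₃ + (δ−g)M₁M₂`): the 14-term edge form has at most `11 < 13 = #terms − 1` positive roots counted with
multiplicity. [folklore] -/
theorem countP_posRoots_zp_5_18_le_of_cert45 (d₁ d₂ d₃ d₄ d₅ : ℕ) (M₀ M₁ M₂ M₃ : ℝ)
    (hM₀ : M₀ = ((d₄ : ℝ) - ((2 * d₂ : ℕ) : ℝ)) * ((d₄ : ℝ) - (d₃ : ℝ)) * ((d₄ : ℝ) - ((d₁ + d₃ : ℕ) : ℝ)) *
        ((d₄ : ℝ) - ((d₂ + d₃ : ℕ) : ℝ)) * ((d₄ : ℝ) - ((2 * d₃ : ℕ) : ℝ)) * ((d₄ : ℝ) - ((d₂ + d₄ : ℕ) : ℝ)) *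
        ((d₄ : ℝ) - ((d₃ + d₄ : ℕ) : ℝ)) * ((d₄ : ℝ) - ((d₂ + d₅ : ℕ) : ℝ)) * ((d₄ : ℝ) - ((2 * d₄ : ℕ) : ℝ)) *
        ((d₄ : ℝ) - ((d₃ + d₅ : ℕ) : ℝ)))
    (hM₁ : M₁ = ((d₅ : ℝ) - ((2 * d₂ : ℕ) : ℝ)) * ((d₅ : ℝ) - (d₃ : ℝ)) * ((d₅ : ℝ) - ((d₁ + d₃ : ℕ) : ℝ)) *
        ((d₅ : ℝ) - ((d₂ + d₃ : ℕ) : ℝ)) * ((d₅ : ℝ) - ((2 * d₃ : ℕ) : ℝ)) * ((d₅ : ℝ) - ((d₂ + d₄ : ℕ) : ℝ)) *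
        ((d₅ : ℝ) - ((d₃ + d₄ : ℕ) : ℝ)) * ((d₅ : ℝ) - ((d₂ + d₅ : ℕ) : ℝ)) * ((d₅ : ℝ) - ((2 * d₄ : ℕ) : ℝ)) *
        ((d₅ : ℝ) - ((d₃ + d₅ : ℕ) : ℝ)))
    (hM₂ : M₂ = (((d₁ + d₄ : ℕ) : ℝ) - ((2 * d₂ : ℕ) : ℝ)) * (((d₁ + d₄ : ℕ) : ℝ) - (d₃ : ℝ)) *
        (((d₁ + d₄ : ℕ) : ℝ) - ((d₁ + d₃ : ℕ) : ℝ)) * (((d₁ + d₄ : ℕ) : ℝ) - ((d₂ + d₃ : ℕ) : ℝ)) *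
        (((d₁ + d₄ : ℕ) : ℝ) - ((2 * d₃ : ℕ) : ℝ)) * (((d₁ + d₄ : ℕ) : ℝ) - ((d₂ + d₄ : ℕ) : ℝ)) *
        (((d₁ + d₄ : ℕ) : ℝ) - ((d₃ + d₄ : ℕ) : ℝ)) * (((d₁ + d₄ : ℕ) : ℝ) - ((d₂ + d₅ : ℕ) : ℝ)) *
        (((d₁ + d₄ : ℕ) : ℝ) - ((2 * d₄ : ℕ) : ℝ)) * (((d₁ + d₄ : ℕ) : ℝ) - ((d₃ + d₅ : ℕ) : ℝ)))
    (hM₃ : M₃ = (((d₁ + d₅ : ℕ) : ℝ) - ((2 * d₂ : ℕ) : ℝ)) * (((d₁ + d₅ : ℕ) : ℝ) - (d₃ : ℝ)) *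
        (((d₁ + d₅ : ℕ) : ℝ) - ((d₁ + d₃ : ℕ) : ℝ)) * (((d₁ + d₅ : ℕ) : ℝ) - ((d₂ + d₃ : ℕ) : ℝ)) *
        (((d₁ + d₅ : ℕ) : ℝ) - ((2 * d₃ : ℕ) : ℝ)) * (((d₁ + d₅ : ℕ) : ℝ) - ((d₂ + d₄ : ℕ) : ℝ)) *
        (((d₁ + d₅ : ℕ) : ℝ) - ((d₃ + d₄ : ℕ) : ℝ)) * (((d₁ + d₅ : ℕ) : ℝ) - ((d₂ + d₅ : ℕ) : ℝ)) *
        (((d₁ + d₅ : ℕ) : ℝ) - ((2 * d₄ : ℕ) : ℝ)) * (((d₁ + d₅ : ℕ) : ℝ) - ((d₃ + d₅ : ℕ) : ℝ)))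
    (hd₁ : 0 < d₁) (hjk : d₄ < d₅) (h₀ : M₀ < 0) (h₁ : M₁ < 0) (h₂ : M₂ < 0) (h₃ : M₃ < 0)
    (hcert : 0 ≤ ((d₁ : ℝ) + ((d₅ : ℝ) - (d₄ : ℝ))) * (M₀ * M₃) + ((d₁ : ℝ) - ((d₅ : ℝ) - (d₄ : ℝ))) * (M₁ * M₂) ∨
      (((d₁ : ℝ) + ((d₅ : ℝ) - (d₄ : ℝ))) * (M₀ * M₃) + ((d₁ : ℝ) - ((d₅ : ℝ) - (d₄ : ℝ))) * (M₁ * M₂)) ^ 2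
        < 4 * (d₁ : ℝ) ^ 2 * (M₀ * M₃) * (M₁ * M₂))
    (a₀ a₁ a₂ a₃ c₃ c₄ c₅ b₂ b₃ b₄ : ℝ) (s₀₄ : 0 < a₀ * c₄) (s₀₅ : 0 < a₀ * c₅) (s₁₄ : a₁ * c₄ < 0)
    (s₁₅ : a₁ * c₅ < 0) :
    (((C a₀ + C a₁ * X ^ d₁ + C a₂ * X ^ d₂ + C a₃ * X ^ d₃)
          * (C c₃ * X ^ d₃ + C c₄ * X ^ d₄ + C c₅ * X ^ d₅)
        - (C b₂ * X ^ d₂ + C b₃ * X ^ d₃ + C b₄ * X ^ d₄) ^ 2 : ℝ[X]).roots.countP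
      (fun x => 0 < x)) ≤ 11 := by
  classical
  set e : ℕ → ℕ := fun t => match t with
    | 0 => d₄ | 1 => d₅ | 2 => d₁ + d₄ | 3 => d₁ + d₅ | 4 => 2 * d₂ | 5 => d₃ | 6 => d₁ + d₃
    | 7 => d₂ + d₃ | 8 => 2 * d₃ | 9 => d₂ + d₄ | 10 => d₃ + d₄ | 11 => d₂ + d₅ | 12 => 2 * d₄
    | 13 => d₃ + d₅ | _ => 0 with he
  set c : ℕ → ℝ := fun t => match t with
    | 0 => a₀ * c₄ | 1 => a₀ * c₅ | 2 => a₁ * c₄ | 3 => a₁ * c₅ | 4 => -(b₂ ^ 2) | 5 => a₀ * c₃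
    | 6 => a₁ * c₃ | 7 => a₂ * c₃ - (b₂ * b₃ + b₂ * b₃) | 8 => a₃ * c₃ - b₃ ^ 2
    | 9 => a₂ * c₄ - (b₂ * b₄ + b₂ * b₄) | 10 => a₃ * c₄ - (b₃ * b₄ + b₃ * b₄) | 11 => a₂ * c₅
    | 12 => -(b₄ ^ 2) | 13 => a₃ * c₅ | _ => 0 with hc
  have hF : ((C a₀ + C a₁ * X ^ d₁ + C a₂ * X ^ d₂ + C a₃ * X ^ d₃)
          * (C c₃ * X ^ d₃ + C c₄ * X ^ d₄ + C c₅ * X ^ d₅)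
        - (C b₂ * X ^ d₂ + C b₃ * X ^ d₃ + C b₄ * X ^ d₄) ^ 2 : ℝ[X])
      = ∑ t ∈ range 14, C (c t) * X ^ (e t) := by
    simp only [Finset.sum_range_succ, Finset.sum_range_zero, zero_add, he, hc, map_mul, map_neg,
      map_pow, map_add, map_sub, pow_add, two_mul]
    ring
  rw [hF]
  clear hF
  have step := countP_posRoots_le_countP_twists 14 e c (Ico 4 14)
  have hcard : (Ico 4 14).card = 10 := by simp
  rw [hcard] at step
  obtain ⟨M, hM⟩ : ∃ M : ℕ → ℝ, ∀ t, M t = ∏ u ∈ Ico 4 14, ((e t : ℝ) - e u) := ⟨_, fun _ => rfl⟩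
  have hres : (∑ t ∈ range 14, C (c t * ∏ u ∈ Ico 4 14, ((e t : ℝ) - e u)) * X ^ (e t) : ℝ[X])
      = C (c 0 * M 0) * X ^ (e 0) + C (c 1 * M 1) * X ^ (e 1) + C (c 2 * M 2) * X ^ (e 2)
        + C (c 3 * M 3) * X ^ (e 3) := by
    rw [Finset.range_eq_Ico, ← Finset.sum_Ico_consecutive _ (show 0 ≤ 4 by norm_num) (show 4 ≤ 14 by norm_num)]
    have hz : (∑ t ∈ Ico 4 14, C (c t * ∏ u ∈ Ico 4 14, ((e t : ℝ) - e u)) * X ^ (e t) : ℝ[X]) = 0 := by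
      refine Finset.sum_eq_zero fun t ht => ?_
      rw [Finset.prod_eq_zero ht (sub_self _), mul_zero, map_zero, zero_mul]
    rw [hz, add_zero, Nat.Ico_zero_eq_range]
    simp only [Finset.sum_range_succ, Finset.sum_range_zero, zero_add, ← hM]
  rw [hres] at step
  clear hres
  have e0 : e 0 = d₄ := rfl
  have e1 : e 1 = d₅ := rfl
  have e2 : e 2 = d₁ + d₄ := rfl
  have e3 : e 3 = d₁ + d₅ := rfl
  have c0 : c 0 = a₀ * c₄ := rfl
  have c1 : c 1 = a₀ * c₅ := rfl
  have c2 : c 2 = a₁ * c₄ := rfl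
  have c3 : c 3 = a₁ * c₅ := rfl
  rw [e0, e1, e2, e3, c0, c1, c2, c3] at step
  have unroll : ∀ t, M t = ((e t : ℝ) - e 4) * ((e t : ℝ) - e 5) * ((e t : ℝ) - e 6) * ((e t : ℝ) - e 7) *
      ((e t : ℝ) - e 8) * ((e t : ℝ) - e 9) * ((e t : ℝ) - e 10) * ((e t : ℝ) - e 11) * ((e t : ℝ) - e 12) *
      ((e t : ℝ) - e 13) := by
    intro t
    rw [hM, Finset.prod_Ico_eq_prod_range]
    simp only [show (14 : ℕ) - 4 = 10 by norm_num, Finset.prod_range_succ, Finset.prod_range_zero, one_mul,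
      Nat.reduceAdd]
  have e4 : e 4 = 2 * d₂ := rfl
  have e5 : e 5 = d₃ := rfl
  have e6 : e 6 = d₁ + d₃ := rfl
  have e7 : e 7 = d₂ + d₃ := rfl
  have e8 : e 8 = 2 * d₃ := rfl
  have e9 : e 9 = d₂ + d₄ := rfl
  have e10 : e 10 = d₃ + d₄ := rfl
  have e11 : e 11 = d₂ + d₅ := rfl
  have e12 : e 12 = 2 * d₄ := rfl
  have e13 : e 13 = d₃ + d₅ := rfl
  have hM0' : M 0 = M₀ := by
    rw [hM₀, unroll, e0, e4, e5, e6, e7, e8, e9, e10, e11, e12, e13]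
  have hM1' : M 1 = M₁ := by
    rw [hM₁, unroll, e1, e4, e5, e6, e7, e8, e9, e10, e11, e12, e13]
  have hM2' : M 2 = M₂ := by
    rw [hM₂, unroll, e2, e4, e5, e6, e7, e8, e9, e10, e11, e12, e13]
  have hM3' : M 3 = M₃ := by
    rw [hM₃, unroll, e3, e4, e5, e6, e7, e8, e9, e10, e11, e12, e13]
  have hA : a₀ * c₄ * M 0 < 0 := by rw [hM0']; exact mul_neg_of_pos_of_neg s₀₄ h₀
  have hB : a₀ * c₅ * M 1 < 0 := by rw [hM1']; exact mul_neg_of_pos_of_neg s₀₅ h₁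
  have hC : 0 < a₁ * c₄ * M 2 := by rw [hM2']; exact mul_pos_of_neg_of_neg s₁₄ h₂
  have hD : 0 < a₁ * c₅ * M 3 := by rw [hM3']; exact mul_pos_of_neg_of_neg s₁₅ h₃
  have hκ : 0 < a₀ * c₅ * -(a₁ * c₄) := mul_pos s₀₅ (neg_pos.2 s₁₄)
  have hg : (((d₅ - d₄ : ℕ) : ℝ)) = (d₅ : ℝ) - (d₄ : ℝ) := by push_cast [hjk.le]; ring
  have iAD : (-(a₀ * c₄ * M 0) * (a₁ * c₅ * M 3)) = (a₀ * c₅ * -(a₁ * c₄)) * (M₀ * M₃) := by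
    rw [hM0', hM3']; ring
  have iBC : (-(a₀ * c₅ * M 1) * (a₁ * c₄ * M 2)) = (a₀ * c₅ * -(a₁ * c₄)) * (M₁ * M₂) := by
    rw [hM1', hM2']; ring
  have hdisc : 0 ≤ ((d₁ : ℝ) + ((d₅ - d₄ : ℕ) : ℝ)) * (-(a₀ * c₄ * M 0) * (a₁ * c₅ * M 3))
        + ((d₁ : ℝ) - ((d₅ - d₄ : ℕ) : ℝ)) * (-(a₀ * c₅ * M 1) * (a₁ * c₄ * M 2)) ∨
      (((d₁ : ℝ) + ((d₅ - d₄ : ℕ) : ℝ)) * (-(a₀ * c₄ * M 0) * (a₁ * c₅ * M 3))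
          + ((d₁ : ℝ) - ((d₅ - d₄ : ℕ) : ℝ)) * (-(a₀ * c₅ * M 1) * (a₁ * c₄ * M 2))) ^ 2
        < 4 * (d₁ : ℝ) ^ 2 * (-(a₀ * c₄ * M 0) * (a₁ * c₅ * M 3)) * (-(a₀ * c₅ * M 1) * (a₁ * c₄ * M 2)) := by
    rw [iAD, iBC, hg]
    set κ := a₀ * c₅ * -(a₁ * c₄) with hκdef
    set md := ((d₁ : ℝ) + ((d₅ : ℝ) - (d₄ : ℝ))) * (M₀ * M₃) + ((d₁ : ℝ) - ((d₅ : ℝ) - (d₄ : ℝ))) * (M₁ * M₂)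
      with hmd
    have i1 : ((d₁ : ℝ) + ((d₅ : ℝ) - (d₄ : ℝ))) * (κ * (M₀ * M₃))
        + ((d₁ : ℝ) - ((d₅ : ℝ) - (d₄ : ℝ))) * (κ * (M₁ * M₂)) = κ * md := by
      rw [hmd]; ring
    have i2 : 4 * (d₁ : ℝ) ^ 2 * (κ * (M₀ * M₃)) * (κ * (M₁ * M₂))
        = κ ^ 2 * (4 * (d₁ : ℝ) ^ 2 * (M₀ * M₃) * (M₁ * M₂)) := by
      ring
    rw [i1, i2]
    rcases hcert with h | h
    · exact Or.inl (mul_nonneg hκ.le h)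
    · right
      rw [mul_pow]
      exact mul_lt_mul_of_pos_left h (pow_pos hκ 2)
  have tet : ((C (a₀ * c₄ * M 0) * X ^ d₄ + C (a₀ * c₅ * M 1) * X ^ d₅ + C (a₁ * c₄ * M 2) * X ^ (d₁ + d₄)
      + C (a₁ * c₅ * M 3) * X ^ (d₁ + d₅) : ℝ[X]).roots.countP (fun x => 0 < x)) ≤ 1 :=
    countP_posRoots_tetranomial_le_one_of_disc' _ _ _ _ hA hB hC hD (g := d₅ - d₄) (δ := d₁)
      hd₁ (Nat.add_sub_of_le hjk.le).symm (Nat.add_comm _ _)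
      (by rw [Nat.add_sub_of_le hjk.le, Nat.add_comm]) hdisc
  exact (step.trans (Nat.add_le_add_right tet _)).trans (by norm_num)

end Summit.ValiantsHypothesis.ValiantsHypothesis.Theorems.LacunarySymmetroidMatrixDescartes.Census
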